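import Summits.Ventures.Crystal3D.Theorems.StickyWulffConstantGenericWallFloorResidualCoverageDefs
import Summits.Ventures.Crystal3D.Theorems.StickyWulffConstantGenericWallFloorStackLedgerLocalSepWideWith
import Summits.Ventures.Crystal3D.Theorems.StickyWulffConstantGenericWallFloorStackLedgerLocalSepWith
import HarnessLib

/-!
# Restatement programme, GENERIC cone: the separated classes AT explicit constants (`SeparatedWideAt`,
# `SeparatedTiltAtCharge c₀`, and the ray-separated branch `¬ RayAlignedAt`)

HONEST FRAMING. Venture `Summits/Ventures/Crystal3D` (cell `crystal3d-full`); helper `--supports` the crux `GenericWallFloor`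
(stmt-Ventures-19480, line `WallLedgerG`) and lane T's uniform port (cf-p1 DECISION (lxvii)(2); 01:24:52Z P5).  Rung credit only
(census-free, standard axioms); F-C1 not moved; E1 (`ExactOnly`) and `StarPairFar` stay BY NAME.

* **`twoSlabLedgerWith_of_separatedWideAt`** — one `C` with `SeparatedWideAt A₁ A₂ → TwoSlabLedgerWith C 10 1 A₁ t₁ A₂ t₂` for all
  translations (`genericWallFloorAt_of_separatedWideAt` with the leaf `twoSlabAdhesionWith_stackLedger_local_sep_wide`, p685913);
* **`twoSlabLedgerWith_of_separatedTiltAtCharge`** — one `C` with `SeparatedTiltAtCharge c₀ A₁ A₂ → TwoSlabLedgerWith C 10 c₀ A₁ t₁ A₂ t₂`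
  for every `c₀` and all translations (the third disjunct of `CoveredAtCharge c₀`; same leaf, flux floor `2c₀`);
* **`twoSlabLedgerWith_chain_of_far`** / **`twoSlabLedgerWith_of_not_rayAlignedAt`** — one `C` with
  `¬ RayAlignedAt A₁ A₂ → TwoSlabLedgerWith C 10 1 A₁ t₁ A₂ t₂` (`genericWallFloorAt_chain_of_far` through
  `twoSlabAdhesion_stackLedger_local_chain` = the leaf `twoSlabAdhesionWith_stackLedger_local_sep` (p685916) on the two chain-frame sets).
WHAT THIS IS NOT: no new mathematics; not the stub; F-C1 not moved.
-/

noncomputable section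

namespace Summit.Ventures.Crystal3D.Theorems

open Summit.Ventures.Crystal3D Finset
open Literature.MathematicalPhysics.StatisticalMechanics (fccStacking barlowStacking IsHaggSeq)
open scoped InnerProductSpace

open scoped Classical in
/-- **`SeparatedWideAt` at explicit constants**: one `C` for all pairs in the wide separated class and all translations,
`TwoSlabLedgerWith C 10 1` (modulo `ExactOnly`(C12-55), `StarPairFar`). -/
theorem twoSlabLedgerWith_of_separatedWideAt : ∃ C : ℝ, ∀
    {s₀ : EuclideanSpace ℝ (Fin 3)} (hs₀ : s₀ ∈ fccSlots)
    (hcert : ExactOnly 0 (fccSlots.filter fun w => 0 < ⟪w, s₀⟫_ℝ)) (hfar : StarPairFar)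
    {A₁ A₂ : EuclideanSpace ℝ (Fin 3) ≃ₗᵢ[ℝ] EuclideanSpace ℝ (Fin 3)} (h : SeparatedWideAt A₁ A₂)
    (t₁ t₂ : EuclideanSpace ℝ (Fin 3)), TwoSlabLedgerWith C 10 1 A₁ t₁ A₂ t₂ := by
  obtain ⟨K, hK⟩ := twoSlabAdhesionWith_stackLedger_local_sep_wide
  refine ⟨(240 * Real.sqrt 2 * Real.pi + 4440 * (4 * 10 + 2)) / 2 + 16000 + K, ?_⟩
  intro s₀ hs₀ hcert hfar A₁ A₂ h t₁ t₂
  obtain ⟨z₁, z₂, u₁, u₂, hz₁, hze₁, hz₂, hze₂, hu₁, hsteep₁, hu₂, hsteep₂, hflux, hsep⟩ := h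
  exact twoSlabLedgerWith_anti (by linarith only [hflux])
    (hK hs₀ hcert (doubleStarCoaxialAt_of_starPairFar hfar)
      (capPairCoaxial_of_starPairFar hfar) A₁ t₁ A₂ t₂ hz₁ hze₁ hz₂ hze₂ hu₁ hsteep₁ hu₂ hsteep₂
      {F | ∃ stk : List WalkEntry, StackSound z₁ stk ∧ StackWF z₁ stk ∧ stk.getLast? = some ⟨A₁, u₁, 0⟩ ∧
        ∃ e ∈ stk, e.frame = F}
      {F | ∃ stk : List WalkEntry, StackSound z₂ stk ∧ StackWF z₂ stk ∧ stk.getLast? = some ⟨A₂, u₂, 0⟩ ∧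
        ∃ e ∈ stk, e.frame = F}
      (fun stk hS hW hl e he => ⟨stk, hS, hW, hl, e, he, rfl⟩)
      (fun stk hS hW hl e he => ⟨stk, hS, hW, hl, e, he, rfl⟩)
      (fun _ ⟨stk₁, hS₁, hW₁, hl₁, e₁, he₁, hF₁⟩ _ ⟨stk₂, hS₂, hW₂, hl₂, e₂, he₂, hF₂⟩ => by
        rw [← hF₁, ← hF₂]
        exact hsep stk₁ hS₁ hW₁ hl₁ e₁ he₁ stk₂ hS₂ hW₂ hl₂ e₂ he₂))

open scoped Classical in
/-- **`SeparatedTiltAtCharge c₀` at explicit constants** (the certificate's SEP class): one `C` (independent of `c₀`) with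
`SeparatedTiltAtCharge c₀ A₁ A₂ → TwoSlabLedgerWith C 10 c₀ A₁ t₁ A₂ t₂` for all translations (modulo `ExactOnly`(C12-55), `StarPairFar`). -/
theorem twoSlabLedgerWith_of_separatedTiltAtCharge : ∃ C : ℝ, ∀
    {s₀ : EuclideanSpace ℝ (Fin 3)} (hs₀ : s₀ ∈ fccSlots)
    (hcert : ExactOnly 0 (fccSlots.filter fun w => 0 < ⟪w, s₀⟫_ℝ)) (hfar : StarPairFar) {c₀ : ℝ}
    {A₁ A₂ : EuclideanSpace ℝ (Fin 3) ≃ₗᵢ[ℝ] EuclideanSpace ℝ (Fin 3)} (h : SeparatedTiltAtCharge c₀ A₁ A₂)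
    (t₁ t₂ : EuclideanSpace ℝ (Fin 3)), TwoSlabLedgerWith C 10 c₀ A₁ t₁ A₂ t₂ := by
  obtain ⟨K, hK⟩ := twoSlabAdhesionWith_stackLedger_local_sep_wide
  refine ⟨(240 * Real.sqrt 2 * Real.pi + 4440 * (4 * 10 + 2)) / 2 + 16000 + K, ?_⟩
  intro s₀ hs₀ hcert hfar c₀ A₁ A₂ h t₁ t₂
  obtain ⟨z₁, z₂, u₁, u₂, hz₁, hze₁, hz₂, hze₂, hu₁, hsteep₁, hu₂, hsteep₂, hflux, hsep⟩ := h
  exact twoSlabLedgerWith_anti (by linarith only [hflux])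
    (hK hs₀ hcert (doubleStarCoaxialAt_of_starPairFar hfar)
      (capPairCoaxial_of_starPairFar hfar) A₁ t₁ A₂ t₂ hz₁ hze₁ hz₂ hze₂ hu₁ hsteep₁ hu₂ hsteep₂
      {F | ∃ stk : List WalkEntry, StackSound z₁ stk ∧ StackWF z₁ stk ∧ stk.getLast? = some ⟨A₁, u₁, 0⟩ ∧
        ∃ e ∈ stk, e.frame = F}
      {F | ∃ stk : List WalkEntry, StackSound z₂ stk ∧ StackWF z₂ stk ∧ stk.getLast? = some ⟨A₂, u₂, 0⟩ ∧
        ∃ e ∈ stk, e.frame = F}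
      (fun stk hS hW hl e he => ⟨stk, hS, hW, hl, e, he, rfl⟩)
      (fun stk hS hW hl e he => ⟨stk, hS, hW, hl, e, he, rfl⟩)
      (fun _ ⟨stk₁, hS₁, hW₁, hl₁, e₁, he₁, hF₁⟩ _ ⟨stk₂, hS₂, hW₂, hl₂, e₂, he₂, hF₂⟩ => by
        rw [← hF₁, ← hF₂]
        exact hsep stk₁ hS₁ hW₁ hl₁ e₁ he₁ stk₂ hS₂ hW₂ hl₂ e₂ he₂))

open scoped Classical in
/-- **The ray-separated branch at explicit constants** (`genericWallFloorAt_chain_of_far` in With-currency): steep slots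
`u₁`/`u₂` with pairwise non-co-axial chain-frame sets give `TwoSlabLedgerWith C 10 1`, one `C` for all data. -/
theorem twoSlabLedgerWith_chain_of_far : ∃ C : ℝ, ∀
    {s₀ : EuclideanSpace ℝ (Fin 3)} (hs₀ : s₀ ∈ fccSlots)
    (hcert : ExactOnly 0 (fccSlots.filter fun w => 0 < ⟪w, s₀⟫_ℝ)) (hfar : StarPairFar)
    (A₁ : EuclideanSpace ℝ (Fin 3) ≃ₗᵢ[ℝ] EuclideanSpace ℝ (Fin 3)) (t₁ : EuclideanSpace ℝ (Fin 3))
    (A₂ : EuclideanSpace ℝ (Fin 3) ≃ₗᵢ[ℝ] EuclideanSpace ℝ (Fin 3)) (t₂ : EuclideanSpace ℝ (Fin 3))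
    {u₁ : EuclideanSpace ℝ (Fin 3)} (hu₁ : u₁ ∈ fccSlots)
    (hsteep₁ : Real.sqrt 2 / 2 ≤ ⟪A₁ u₁, EuclideanSpace.single (2 : Fin 3) (1 : ℝ)⟫_ℝ)
    {u₂ : EuclideanSpace ℝ (Fin 3)} (hu₂ : u₂ ∈ fccSlots)
    (hsteep₂ : ⟪A₂ u₂, EuclideanSpace.single (2 : Fin 3) (1 : ℝ)⟫_ℝ ≤ -(Real.sqrt 2 / 2))
    (hsep : ∀ F₁ ∈ chainFrames (EuclideanSpace.single (2 : Fin 3) (1 : ℝ)) A₁ u₁,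
      ∀ F₂ ∈ chainFrames (-EuclideanSpace.single (2 : Fin 3) (1 : ℝ)) A₂ u₂,
      ¬ ∃ (L : EuclideanSpace ℝ (Fin 3) ≃ₗᵢ[ℝ] EuclideanSpace ℝ (Fin 3))
        (s₁ s₂ : EuclideanSpace ℝ (Fin 3)) (σ σ' : ℤ → ℤ), IsHaggSeq σ ∧ IsHaggSeq σ' ∧
        F₁ '' fccStacking 1 (Real.sqrt (2 / 3)) ⊆ (fun p => L p + s₁) '' barlowStacking 1 (Real.sqrt (2 / 3)) σ ∧
        F₂ '' fccStacking 1 (Real.sqrt (2 / 3)) ⊆ (fun p => L p + s₂) '' barlowStacking 1 (Real.sqrt (2 / 3)) σ'),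
    TwoSlabLedgerWith C 10 1 A₁ t₁ A₂ t₂ := by
  obtain ⟨K, hK⟩ := twoSlabAdhesionWith_stackLedger_local_sep
  refine ⟨(240 * Real.sqrt 2 * Real.pi + 4440 * (4 * 10 + 2)) / 2 + 2000 + K, ?_⟩
  intro s₀ hs₀ hcert hfar A₁ t₁ A₂ t₂ u₁ hu₁ hsteep₁ u₂ hu₂ hsteep₂ hsep
  have hledger := hK hs₀ hcert (doubleStarCoaxialAt_of_starPairFar hfar) (capPairCoaxial_of_starPairFar hfar) A₁ t₁ A₂ t₂
    hu₁ hsteep₁ hu₂ hsteep₂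
    (chainFrames (EuclideanSpace.single (2 : Fin 3) (1 : ℝ)) A₁ u₁)
    (chainFrames (-EuclideanSpace.single (2 : Fin 3) (1 : ℝ)) A₂ u₂)
    (fun _ hS hW hlast => frame_mem_chainFrames_of_stack hS hW hlast)
    (fun _ hS hW hlast => frame_mem_chainFrames_of_stack hS hW hlast) hsep
  have hκ₁ := one_le_flux_of_steep (A := A₁) (u := u₁) (le_trans hsteep₁ (le_abs_self _))
  have hκ₂ : 1 ≤ Real.sqrt 2 * |⟪A₂ u₂, EuclideanSpace.single (2 : Fin 3) (1 : ℝ)⟫_ℝ| := by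
    refine one_le_flux_of_steep (A := A₂) (u := u₂) ?_
    rw [abs_of_nonpos (by linarith only [hsteep₂, Real.sqrt_nonneg 2] :
      ⟪A₂ u₂, EuclideanSpace.single (2 : Fin 3) (1 : ℝ)⟫_ℝ ≤ 0)]
    linarith only [hsteep₂]
  exact twoSlabLedgerWith_anti (by linarith only [hκ₁, hκ₂]) hledger

/-- **`¬ RayAlignedAt` at explicit constants**: one `C` with `¬ RayAlignedAt A₁ A₂ → TwoSlabLedgerWith C 10 1 A₁ t₁ A₂ t₂` for all
translations (modulo `ExactOnly`(C12-55), `StarPairFar`), by `exists_separated_of_not_rayAlignedAt`. -/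
theorem twoSlabLedgerWith_of_not_rayAlignedAt : ∃ C : ℝ, ∀
    {s₀ : EuclideanSpace ℝ (Fin 3)} (hs₀ : s₀ ∈ fccSlots)
    (hcert : ExactOnly 0 (fccSlots.filter fun w => 0 < ⟪w, s₀⟫_ℝ)) (hfar : StarPairFar)
    {A₁ A₂ : EuclideanSpace ℝ (Fin 3) ≃ₗᵢ[ℝ] EuclideanSpace ℝ (Fin 3)} (h : ¬ RayAlignedAt A₁ A₂)
    (t₁ t₂ : EuclideanSpace ℝ (Fin 3)), TwoSlabLedgerWith C 10 1 A₁ t₁ A₂ t₂ := by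
  obtain ⟨C, hC⟩ := twoSlabLedgerWith_chain_of_far
  refine ⟨C, ?_⟩
  intro s₀ hs₀ hcert hfar A₁ A₂ h t₁ t₂
  obtain ⟨u₁, hu₁, hst₁, u₂, hu₂, hst₂, hsep⟩ := exists_separated_of_not_rayAlignedAt h
  exact hC hs₀ hcert hfar A₁ t₁ A₂ t₂ hu₁ hst₁ hu₂ hst₂ hsep

end Summit.Ventures.Crystal3D.Theorems

end
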